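import Summits.AnomalousDissipation.AnomalousDissipation.Theses.MinimaxWork

/-!
# Junction glue of the certificate split of `InviscidWork.BilateralSelection` (stmt-AnomalousDissipation-30039) — MinimaxWork

Sorry-free proof of the GLUE item `MinimaxWork.CertificateGlue` (stmt-AnomalousDissipation-32335):
`LowerCertificate → CertificateUpgrade → CertificateToolkit → BilateralSelection`.
Mechanism (lens-6 g10 kernel `refines_30039_toolkit` = `certificate_glue ∘ bilateral_iff_tree`): the upgrade turns the lower certificate
into two-sided certificates (forward carrier and its exact mirror `−v_j`); `CertificateToolkit` = steady-state existence ∧ certificate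
bounds gives, for each `j`, mean-zero `L²` steady states `w_j`, `w'_j` of the forward / mirror problems whose WORK is floored by the
lower certificate value `ε` and whose `L²` norm is ceilinged by `8C + Γ/(2π²)`; the mirror carriers are smooth, divergence-free and
converge to `−∇⊥ψ`; the constant-signal `limsup` mean is the constant.  No facts are asserted.
Source: decomp-ad cell, lens-6 g10 node «MinimaxWork» (kernel `run/shared/lean/pub/decomp-ad/decomp-ad-lens-6/MinimaxWork.lean`,
theorems `steady_mean`, `mirror_carrier`, `mirror_tendsto`, `mirror_of_certificates`, `mirror_implies_bilateral`,
`bilateral_of_certificates`, `refines_30039_toolkit`); landed by the cell's prover seat against the tree's inlined texts.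
-/

set_option linter.dupNamespace false

open MeasureTheory Filter Topology Set
open scoped ENNReal NNReal

noncomputable section

namespace Summit.AnomalousDissipation.AnomalousDissipation.Theorems.CertificateGlue

open Literature.Analysis.FunctionSpaces Literature.Analysis.FunctionSpaces.Torus
open Literature.Analysis.FluidPDE Literature.Analysis.FluidPDE.Torus
open Summit.AnomalousDissipation.AnomalousDissipation.Theses.MinimaxWork

/-- The exact mirror `−v` of a smooth divergence-free planar carrier is smooth and divergence-free. [folklore] -/
theorem mirror_carrier {v : UnitAddTorus (Fin 2) → EuclideanSpace ℝ (Fin 2)} (hs : IsSmooth v) (hd : IsDivFree v) :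
    IsSmooth (fun x => -v x) ∧ IsDivFree (fun x => -v x) := by
  refine ⟨hs.neg, fun x => ?_⟩
  have h := hd x
  have key : ∀ i : Fin 2, partialDeriv i (fun y => (-v y) i) x = -partialDeriv i (fun y => v y i) x := by
    intro i
    show Torus.lineDeriv (fun y => (-v y) i) x (EuclideanSpace.single i 1) =
      -Torus.lineDeriv (fun y => v y i) x (EuclideanSpace.single i 1)
    unfold Torus.lineDeriv
    simp only [PiLp.neg_apply]
    exact deriv.neg
  unfold divergence at h ⊢
  simp only [key, Finset.sum_neg_distrib, h, neg_zero]

/-- `(−v) − (−b) = −(v − b)`: the mirror carriers converge to the mirror limit in `L²` exactly as fast. [folklore] -/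
theorem mirror_tendsto {b : UnitAddTorus (Fin 2) → EuclideanSpace ℝ (Fin 2)} {v : ℕ → UnitAddTorus (Fin 2) → EuclideanSpace ℝ (Fin 2)}
    (hconv : Tendsto (fun j => eLpNorm (v j - b) 2 volume) atTop (𝓝 0)) :
    Tendsto (fun j => eLpNorm ((fun x => -v j x) - fun x => -b x) 2 volume) atTop (𝓝 0) := by
  have e : ∀ j, ((fun x => -v j x) - fun x => -b x) = -(v j - b) := by
    intro j; funext x; simp only [Pi.sub_apply, Pi.neg_apply]; abel
  simp_rw [e, eLpNorm_neg]
  exact hconv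

/-- The GLUE item `MinimaxWork.CertificateGlue` (stmt-AnomalousDissipation-32335) holds: certificates ⟹ exact-mirror selection ⟹
bilateral selection (tree item 30039's text). [folklore] -/
theorem certificateGlue_holds : CertificateGlue := by
  intro hL hU hT ψ hRA hIW
  obtain ⟨hE, hB⟩ := hT
  -- the `limsup` Cesàro mean of a constant signal is the constant (= tree `TwohalfdNeg.Negative.longTimeAvgSup_const_fun`,
  -- re-derived locally to keep this file's import closure inside the route file's)
  have hmean : ∀ c : ℝ, longTimeAvgSup (fun _ : ℝ => c) = c := by
    intro c
    have hc : (timeMean (fun _ : ℝ => c)) =ᶠ[atTop] fun _ => c := by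
      filter_upwards [eventually_gt_atTop (0 : ℝ)] with T hT
      rw [timeMean, intervalIntegral.integral_const, smul_eq_mul, sub_zero]
      field_simp
    unfold longTimeAvgSup
    rw [Filter.limsup_congr hc, Filter.limsup_const]
  obtain ⟨h, hh, hh0, -, F, ν, Fs, v, hF, hC, C, ε, Γ, hε, hfwd, hmir⟩ := hU hL ψ hRA hIW
  obtain ⟨hν, hν0, hFs, hFconv, hv, hLH, hEn, hconv, hgrad⟩ := hC
  have hvm : ∀ j, IsSmooth (fun x => -v j x) ∧ IsDivFree (fun x => -v j x) :=
    fun j => mirror_carrier (hv j).1 (hv j).2.1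
  choose w hw using fun j => hE (ν j) (v j) h (hν j) (hv j).1 (hv j).2.1 hh hh0
  choose w' hw' using fun j => hE (ν j) (fun x => -v j x) h (hν j) (hvm j).1 (hvm j).2 hh hh0
  -- forward bounds: work floor ε and L² ceiling
  have bf : ∀ j, ε ≤ (∫ x, h x * w j x) ∧ scalarL2Sq (w j) ≤ 4 * (C + C) + Γ / (2 * Real.pi ^ 2) := by
    intro j
    obtain ⟨φ, z, u, y, ⟨hPL, hφ, hz, hJ⟩, ⟨hUL, hgap⟩⟩ := hfwd j
    obtain ⟨hJw, hL2⟩ := hB (ν j) (v j) h (w j) φ z u y Γ (hν j) (hv j).1 (hv j).2.1 hh (hw j).1 (hw j).2.1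
      (hw j).2.2 hPL hUL hgap
    exact ⟨le_trans hJ hJw, by linarith [hL2, hφ, hz]⟩
  -- mirror bounds
  have bm : ∀ j, ε ≤ (∫ x, h x * w' j x) ∧ scalarL2Sq (w' j) ≤ 4 * (C + C) + Γ / (2 * Real.pi ^ 2) := by
    intro j
    obtain ⟨φ, z, u, y, ⟨hPL, hφ, hz, hJ⟩, ⟨hUL, hgap⟩⟩ := hmir j
    obtain ⟨hJw, hL2⟩ := hB (ν j) (fun x => -v j x) h (w' j) φ z u y Γ (hν j) (hvm j).1 (hvm j).2 hh (hw' j).1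
      (hw' j).2.1 (hw' j).2.2 hPL hUL hgap
    exact ⟨le_trans hJ hJw, by linarith [hL2, hφ, hz]⟩
  refine ⟨h, ⟨hh, hh0, F, ν, Fs, v, w, hF, ⟨hν, hν0, hFs, hFconv, hv, hLH, hEn, hconv, hgrad⟩, ?_⟩, ?_⟩
  · refine ⟨⟨fun j => (hw j).1, fun j => (hw j).2.2, 4 * (C + C) + Γ / (2 * Real.pi ^ 2), fun j => ?_⟩, ε, hε,
      fun j => (bf j).1⟩
    rw [hmean]; exact (bf j).2
  · refine ⟨ν, fun j x => -v j x, w', ⟨hν, hν0, fun j => hvm j, mirror_tendsto hconv⟩, ?_⟩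
    refine ⟨⟨fun j => (hw' j).1, fun j => (hw' j).2.2, 4 * (C + C) + Γ / (2 * Real.pi ^ 2), fun j => ?_⟩, ε, hε,
      fun j => (bm j).1⟩
    rw [hmean]; exact (bm j).2

end Summit.AnomalousDissipation.AnomalousDissipation.Theorems.CertificateGlue

end
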